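import Mathlib
import Summits.ValiantsHypothesis.ValiantsHypothesis.Theorems.FifoMatchingNNNotVPSupportFnCliqueProjection
import HarnessLib

/-!
# Route FifoMatching — crux `NNNotVP` (stmt-ValiantsHypothesis-11615), line `division_split`:
# padding projections of nest-free matching existence, and the gadget hypothesis along a sequence

Registered line `Cruxes/NNNotVP/Lines/division_split.lean`; objects `σ` / `NN` / `SuppFn` /
`freeVars` = the line's vocabulary (`Theorems/FifoMatchingNNNotVPDivisionSplitDefs.lean`).

The companion `…SupportFnCliqueProjection` reduces stub A (`stub_supportFnHard`) to a clique-like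
monotone projection of nest-free perfect-matching existence for ALL large `n`.  A gadget is
naturally built along ONE sequence `n = n(m)`; this file closes the gap:

* `exists_padding_projection` — for `1 ≤ n' ≤ n`, nest-free perfect-matching existence on `[2n']`
  is a monotone PROJECTION of the one on `[2n]`: keep the arcs inside `[0, 2n')`, switch ON the
  consecutive pairs `(2n' + 2t, 2n' + 2t + 1)` and OFF everything else (carving
  `FifoMatchingNNLowDegreeCofactorHardCarveMatchings`: `Carving.extend` / `Carving.restrict`);
* `supportFnHard_of_cliqueProjection_seq` — stub A VERBATIM from the gadget hypothesis ALONG A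
  SEQUENCE: for all large `m` SOME `n ≤ m^{C₀}`, `n ≥ 1`, and a projection
  `σ n → E(K_m) ⊕ Bool` under which NFPM-existence accepts every `⌊√m⌋`-clique vector and rejects
  every `(⌊√m⌋ - 1)`-colouring vector (pad from `n(m)` to any `N` with `m = ⌊N^{1/C₀}⌋`).

Honest framing: a reduction; the gadget is NOT constructed here, stubs Z / A / B2, the crux
`NNNotVP` and `VP ≠ VNP` stay OPEN (NOT proved).  No definitions, no named facts.
-/

noncomputable section

-- Sub = Summit single-conjunct layout: the duplicated namespace component is mandated by the tree.
set_option linter.dupNamespace false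

namespace Summit.ValiantsHypothesis.ValiantsHypothesis.Theorems.FifoMatching.NNNotVP.DivisionSplit

open MvPolynomial Literature.Computability.AlgebraicComplexity
open Literature.Computability.Complexity
open Summit.ValiantsHypothesis.ValiantsHypothesis.Theorems.FifoMatching.NNLowDegreeCofactorHard.FreedVertices
open scoped NNReal BigOperators Classical

/-! ### Padding -/

/-- **Padding projection.**  For `1 ≤ n' ≤ n` there is a projection `e : σ n → σ n' ⊕ Bool`
(arcs inside `[0, 2n')` kept, the consecutive pairs beyond switched on, all other arcs off) with
`NFPM_n (x ∘ e) = NFPM_{n'} (x)` for every arc vector `x` of `[2n']`. [folklore] -/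
theorem exists_padding_projection {n' n : ℕ} (h1 : 1 ≤ n') (h : n' ≤ n) :
    ∃ e : σ n → σ n' ⊕ Bool, ∀ x : σ n' → Bool,
      decide (SuppFn (NN n) (Finset.univ.filter fun a : σ n => Sum.elim x id (e a) = true)) =
        decide (SuppFn (NN n') (Finset.univ.filter fun a : σ n' => x a = true)) := by
  let C : Carve.Carving n := ⟨0, n', by omega, h1, rfl⟩
  have hmemI : ∀ i : Fin (2 * n), i ∈ C.I ↔ (i : ℕ) < 2 * n' := fun i => by
    rw [C.mem_I]; simp [C]
  let e : σ n → σ n' ⊕ Bool := fun a =>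
    if a.1 ∈ C.I ∧ a.2 ∈ C.I then Sum.inl (C.dn a.1, C.dn a.2)
    else Sum.inr (decide (a.1 ∉ C.I ∧ a.2 = Carve.partner a.1))
  refine ⟨e, fun x => ?_⟩
  rw [Bool.eq_iff_iff, nfpmExists_eq_true_iff, nfpmExists_eq_true_iff]
  constructor
  · -- a matching of `[2n]` on in the padded vector stays inside `[0, 2n')` there; restrict it
    rintro ⟨M, hM, hMx⟩
    obtain ⟨hperf, -⟩ := mem_nestFreeMatchings.1 hM
    obtain ⟨hinv, hfp⟩ := mem_perfectMatchings.1 hperf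
    have hI : ∀ j, M (C.up j) ∈ C.I := by
      intro j
      have hi : C.up j ∈ C.I := C.up_mem_I j
      by_contra hout
      rcases lt_or_gt_of_ne (hfp (C.up j)) with hlt | hgt
      · -- `M i < i`: the arc `(M i, i)` is on, but `M i ∉ I`, `i ∈ I`
        have h' := hMx (M (C.up j)) (by rw [hinv]; exact hlt)
        rw [hinv] at h'
        have he : e (M (C.up j), C.up j) = Sum.inr false := by
          simp only [e]
          rw [if_neg (fun h => hout h.1)]
          congr 1
          rw [decide_eq_false_iff_not]
          rintro ⟨-, heq⟩
          exact C.partner_not_mem_I hout (heq ▸ hi)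
        rw [he] at h'
        exact Bool.false_ne_true h'
      · -- `i < M i`: the arc `(i, M i)` is on, but `M i ∉ I`
        have h' := hMx (C.up j) hgt
        have he : e (C.up j, M (C.up j)) = Sum.inr false := by
          simp only [e]
          rw [if_neg (fun h => hout h.2)]
          congr 1
          rw [decide_eq_false_iff_not]
          rintro ⟨hni, -⟩
          exact hni hi
        rw [he] at h'
        exact Bool.false_ne_true h'
    refine ⟨C.restrict M, C.restrict_mem_nestFreeMatchings hM hI, fun j hj => ?_⟩
    have hlt : C.up j < M (C.up j) := (C.lt_restrict_iff hI j).1 hj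
    have h' := hMx (C.up j) hlt
    have he : e (C.up j, M (C.up j)) = Sum.inl (j, C.restrict M j) := by
      simp only [e]
      rw [if_pos ⟨C.up_mem_I j, hI j⟩, C.dn_up]
      rfl
    rw [he] at h'
    exact h'
  · -- a matching of `[2n']` extends by consecutive pairs
    rintro ⟨N, hN, hNx⟩
    refine ⟨C.extend N, C.extend_mem_nestFreeMatchings hN, fun i hi => ?_⟩
    by_cases hiI : i ∈ C.I
    · have hMi : C.extend N i = C.up (N (C.dn i)) := C.extend_apply_of_mem N hiI
      have hj : C.dn i < N (C.dn i) := by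
        rw [← C.up_lt_up, C.up_dn hiI, ← hMi]; exact hi
      have he : e (i, C.extend N i) = Sum.inl (C.dn i, N (C.dn i)) := by
        simp only [e]
        rw [if_pos ⟨hiI, (C.extend_mem_I_iff N i).2 hiI⟩, hMi, C.dn_up]
      rw [he]
      exact hNx _ hj
    · have hMi : C.extend N i = Carve.partner i := C.extend_apply_of_not_mem N hiI
      have he : e (i, C.extend N i) = Sum.inr true := by
        simp only [e]
        rw [if_neg (fun h => hiI h.1), hMi]
        congr 1
        rw [decide_eq_true_iff]
        exact ⟨hiI, rfl⟩
      rw [he]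
      rfl

/-! ### The gadget hypothesis along a sequence -/

/-- **Stub A (`stub_supportFnHard`) VERBATIM from the gadget hypothesis along a sequence.**  If for
all large `m` there are SOME `n`, `1 ≤ n ≤ m^{C₀}`, and a projection `e : σ n → E(K_m) ⊕ Bool`
under which nest-free perfect-matching existence on `[2n]` accepts the clique vector of every
`⌊√m⌋`-set and rejects the colouring vector of every `(⌊√m⌋ - 1)`-colouring, then stub A holds:
pad (`exists_padding_projection`) from `n(m)` to an arbitrary large `N`, `m = ⌊N^{1/C₀}⌋`, so
that `N ≤ m^{C₀ + 1}`, and apply `supportFnHard_of_cliqueProjection`. [folklore] -/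
theorem supportFnHard_of_cliqueProjection_seq (C₀ : ℕ)
    (hP : ∃ m₀ : ℕ, ∀ m ≥ m₀, ∃ n : ℕ, 1 ≤ n ∧ n ≤ m ^ C₀ ∧ ∃ e : σ n → KEdge m ⊕ Bool,
      (∀ Z : Finset (Fin m), Z.card = Nat.sqrt m →
        decide (SuppFn (NN n) (Finset.univ.filter fun a : σ n =>
          Sum.elim (cliqueVec Z) id (e a) = true)) = true) ∧
      (∀ O : Fin m → Fin (Nat.sqrt m - 1),
        decide (SuppFn (NN n) (Finset.univ.filter fun a : σ n =>
          Sum.elim (colorVec O) id (e a) = true)) = false)) :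
    ∀ k c : ℕ, ∃ n₀ : ℕ, ∀ n ≥ n₀, ∀ T : Finset (σ n), T.card ≤ (Nat.log 2 n + k) ^ k →
      ∀ g : MvPolynomial (σ n) ℝ≥0, (∀ A : Finset (σ n), SuppFn g A ↔ SuppFn (freeVars T (NN n)) A) →
        2 ^ ((Nat.log 2 n + c) ^ c) < complexity g := by
  obtain ⟨m₀, hm₀⟩ := hP
  apply supportFnHard_of_cliqueProjection (C₀ + 1)
  -- for every large `N` a suitable `m` with `m₀ ≤ m`, `n(m) ≤ N ≤ m^(C₀+1)`
  have hchoice : ∃ N₀ : ℕ, ∀ N ≥ N₀, ∃ m ≥ m₀, m ^ C₀ ≤ N ∧ N ≤ m ^ (C₀ + 1) := by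
    rcases Nat.eq_zero_or_pos C₀ with hC | hC
    · subst hC
      refine ⟨1, fun N hN => ⟨max N m₀, le_max_right _ _, by simpa using hN, ?_⟩⟩
      simp
    · refine ⟨(max m₀ (2 ^ C₀)) ^ C₀, fun N hN => ?_⟩
      set m : ℕ := Nat.nthRoot C₀ N with hm
      have hmge : max m₀ (2 ^ C₀) ≤ m := (Nat.le_nthRoot_iff (by omega)).2 hN
      have hm₀ : m₀ ≤ m := le_trans (le_max_left _ _) hmge
      have hm2 : 2 ^ C₀ ≤ m := le_trans (le_max_right _ _) hmge
      refine ⟨m, hm₀, ?_, ?_⟩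
      · have hN0 : N ≠ 0 := by
          have : 1 ≤ (max m₀ (2 ^ C₀)) ^ C₀ := Nat.one_le_pow _ _ (by positivity)
          omega
        exact (Nat.pow_nthRoot_le_iff).2 (Or.inr hN0)
      · have h1 : N < (m + 1) ^ C₀ := Nat.lt_pow_nthRoot_add_one (by omega) N
        have h2m : 1 ≤ 2 ^ C₀ := Nat.one_le_two_pow
        have h2 : (m + 1) ^ C₀ ≤ (2 * m) ^ C₀ := Nat.pow_le_pow_left (by omega) _
        have h3 : (2 * m) ^ C₀ ≤ m ^ (C₀ + 1) := by
          rw [mul_pow, pow_succ, mul_comm]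
          exact Nat.mul_le_mul_left _ hm2
        omega
  obtain ⟨N₀, hN₀⟩ := hchoice
  refine ⟨max N₀ 1, fun N hN => ?_⟩
  obtain ⟨m, hmm₀, hmN, hNm⟩ := hN₀ N (le_trans (le_max_left _ _) hN)
  obtain ⟨n, hn1, hnm, e, hacc, hrej⟩ := hm₀ m hmm₀
  obtain ⟨eP, heP⟩ := exists_padding_projection (n' := n) (n := N) hn1 (hnm.trans hmN)
  -- the composite projection `σ N → σ n ⊕ Bool → E(K_m) ⊕ Bool`
  have key : ∀ y : KEdge m → Bool,
      decide (SuppFn (NN N) (Finset.univ.filter fun a : σ N =>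
        Sum.elim y id (Sum.elim (fun a' => e a') Sum.inr (eP a)) = true)) =
      decide (SuppFn (NN n) (Finset.univ.filter fun a : σ n => Sum.elim y id (e a) = true)) := by
    intro y
    rw [← heP (fun a' => Sum.elim y id (e a'))]
    have hfilter : (Finset.univ.filter fun a : σ N =>
          Sum.elim y id (Sum.elim (fun a' => e a') Sum.inr (eP a)) = true) =
        Finset.univ.filter fun a : σ N =>
          Sum.elim (fun a' => Sum.elim y id (e a')) id (eP a) = true := by
      apply Finset.filter_congr
      intro a _
      rcases eP a with a' | b
      · exact Iff.rfl
      · exact Iff.rfl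
    rw [hfilter]
  refine ⟨m, hNm, fun a => Sum.elim (fun a' => e a') Sum.inr (eP a), ?_, ?_⟩
  · intro Z hZ
    rw [key]
    exact hacc Z hZ
  · intro O
    rw [key]
    exact hrej O

end Summit.ValiantsHypothesis.ValiantsHypothesis.Theorems.FifoMatching.NNNotVP.DivisionSplit

end
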